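/-
Copyright (c) 2026. All rights reserved.
Released under Apache 2.0 license as described in the file LICENSE.
Authors: HodgeCM publication cell (pub-hodgecm), model-construction sub-cell, construction prover `mc-weil-1`.
-/
import Literature.RepresentationTheory.HeisenbergGroup.TateWeylPair
import Literature.RepresentationTheory.MoeglinVignerasWaldspurger1987.MetaplecticCovers

/-!
# The local Weil (metaplectic-type) group `S̃p_ψ(W)` of a model and the exact sequence (B)

Topic `RepresentationTheory/HeisenbergGroup`; namespace `Literature.RepresentationTheory.HeisenbergGroup`.

§1 (KERNEL, any model). For a representation `ρ` of `Heisenberg B` on `S` and `2` invertible, MVW's group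
`S̃p_ψ(W) ⊂ Sp(W) × GL(S)` of pairs `(g, M)` satisfying (A) — here `MpPsi ρ`, the pull-back of the subgroup
`mpPairs ρ ≤ PseudoSymplectic B × (S ≃ₗ S)` (`SchrodingerSiegelParabolic.lean`) along
`ofSymplectic B : Sp(alt B) →* PseudoSymplectic B` (dictionary: MVW's Heisenberg law `t+t'+½⟨w,w'⟩` and action
`g(w,t) = (gw,t)` correspond, under `(w,t) ↦ (w, t - ½B(w,w))`, to our law `t+t'+B(w,w')` and the action of
`ofSymplectic g = (g, w ↦ ½(B(gw,gw)-B(w,w)))`) — with the maps of (B): `MpPsi.proj : MpPsi ρ →* Sp` (`p`) and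
`MpPsi.ofScalar : kˣ →* MpPsi ρ` (`i`, `c ↦ (1, c·id)`); `i` is injective, central, `p ∘ i = 1`.

§2 (KERNEL over two hypotheses). The predicates `ExistsImplementer ρ` ("for every `g ∈ Sp(W)` some `M ∈ GL(S)`
satisfies (A)") and `ImplementerUniqueUpToScalar ρ` ("such an `M` is unique up to a scalar") and the theorem
`isCentralExt_MpPsi`: under both, (B) `1 → kˣ → MpPsi ρ → Sp(W) → 1` is a central extension in the tree's sense
`MoeglinVignerasWaldspurger1987.IsCentralExt` (central image, `ker p ⊆ im i`, `p` surjective), plus `ker p = im i`.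

§3 NO PRINT RECORDS (referee mc-ref2 audit #7, B2: MVW II.1 speaks of "un modèle de la représentation
métaplectique", and instantiating it at the constructed `schrodingerSB` would fold MVW I.3 + II.6 + the group dictionary
into the citation). Instead the two inputs of (B) stay the PREDICATES of §2, to be discharged per model:
`ExistsImplementer (schrodingerSB …)` is KERNEL in rank one (`RankOneGeneration.lean`: `Sp = ⟨m(t), n(s), w⟩` and the
landed Levi / unipotent / Weyl pairs); `ImplementerUniqueUpToScalar (schrodingerSB …)` (= the commutant of the smooth
Schrödinger model is `ℂ`, MVW I.3 + Schur) is an explicit HYPOTHESIS wherever used, until proved in the tree.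
-/

set_option autoImplicit false

noncomputable section

namespace Literature.RepresentationTheory.HeisenbergGroup

open Literature.RepresentationTheory.MoeglinVignerasWaldspurger1987 (IsCentralExt)

universe u v u' v'

/-! ## §1 The group `MpPsi ρ` and the maps of (B) -/

section MpPsi

variable {R : Type u} [CommRing R] [Invertible (2 : R)] {V : Type v} [AddCommGroup V] [Module R V]
  {B : V →ₗ[R] V →ₗ[R] R}
variable {k : Type u'} [CommRing k] {S : Type v'} [AddCommGroup S] [Module k S]
variable (ρ : Representation k (Heisenberg B) S)

/-- **MVW's `S̃p_ψ(W)`** for the model `ρ`: the subgroup of `Sp(W) × GL(S)` of pairs `(g, M)` with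
`M ρ(h) M⁻¹ = ρ(g·h)` for all `h` (condition (A), `g` acting through `ofSymplectic`).
[cite: MoeglinVignerasWaldspurger1987, Chap. 2 II.1 (A)] -/
def MpPsi : Subgroup (symplecticGroup B × (S ≃ₗ[k] S)) :=
  (mpPairs ρ).comap ((ofSymplectic B).prodMap (MonoidHom.id (S ≃ₗ[k] S)))

/-- membership in `MpPsi ρ` is condition (A) for `ofSymplectic g`. [cite: MoeglinVignerasWaldspurger1987, Chap. 2 II.1 (A)] -/
@[simp] theorem mem_MpPsi (p : symplecticGroup B × (S ≃ₗ[k] S)) :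
    p ∈ MpPsi ρ ↔ Implements ρ (ofSymplectic B p.1) p.2 := Iff.rfl

/-- the projection `p : (g, M) ↦ g` of (B). [cite: MoeglinVignerasWaldspurger1987, Chap. 2 II.1 (B)] -/
def MpPsi.proj : MpPsi ρ →* symplecticGroup B := (MonoidHom.fst _ _).comp (MpPsi ρ).subtype

/-- formula. [cite: MoeglinVignerasWaldspurger1987, Chap. 2 II.1 (B)] -/
@[simp] theorem MpPsi.proj_apply (x : MpPsi ρ) : MpPsi.proj ρ x = (x : symplecticGroup B × (S ≃ₗ[k] S)).1 := rfl

/-- the operator component `(g, M) ↦ M`. [cite: MoeglinVignerasWaldspurger1987, Chap. 2 II.1 (A)] -/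
def MpPsi.toOp : MpPsi ρ →* (S ≃ₗ[k] S) := (MonoidHom.snd _ _).comp (MpPsi ρ).subtype

/-- formula. [cite: MoeglinVignerasWaldspurger1987, Chap. 2 II.1 (A)] -/
@[simp] theorem MpPsi.toOp_apply (x : MpPsi ρ) : MpPsi.toOp ρ x = (x : symplecticGroup B × (S ≃ₗ[k] S)).2 := rfl

/-- the scalar operator `c · id_S` as a linear automorphism. [folklore] -/
def scalarOp (c : kˣ) : S ≃ₗ[k] S := DistribMulAction.toLinearEquiv k S c

/-- formula. [folklore] -/
@[simp] theorem scalarOp_apply (c : kˣ) (f : S) : scalarOp c f = (c : k) • f := rfl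

/-- scalars satisfy (A) for `g = 1`. [cite: MoeglinVignerasWaldspurger1987, Chap. 2 II.1 (B)] -/
theorem one_scalarOp_mem_MpPsi (c : kˣ) : ((1 : symplecticGroup B), scalarOp (S := S) c) ∈ MpPsi ρ := by
  rw [mem_MpPsi]
  intro h f
  simp only [map_one, Heisenberg.PseudoSymplectic.act_one, scalarOp_apply, map_smul]

/-- the map `i : c ↦ (1, c·id)` of (B). [cite: MoeglinVignerasWaldspurger1987, Chap. 2 II.1 (B)] -/
def MpPsi.ofScalar : kˣ →* MpPsi ρ where
  toFun c := ⟨((1 : symplecticGroup B), scalarOp c), one_scalarOp_mem_MpPsi ρ c⟩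
  map_one' := by
    apply Subtype.ext
    refine Prod.ext rfl (LinearEquiv.ext fun f => ?_)
    simp
  map_mul' c c' := by
    apply Subtype.ext
    refine Prod.ext (by simp) (LinearEquiv.ext fun f => ?_)
    simp only [Subgroup.coe_mul, Prod.snd_mul, LinearEquiv.mul_apply, scalarOp_apply, Units.val_mul, smul_smul]

/-- components of `i c`. [cite: MoeglinVignerasWaldspurger1987, Chap. 2 II.1 (B)] -/
@[simp] theorem MpPsi.coe_ofScalar (c : kˣ) :
    ((MpPsi.ofScalar ρ c : MpPsi ρ) : symplecticGroup B × (S ≃ₗ[k] S)) = (1, scalarOp c) := rfl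

/-- `p ∘ i = 1`. [cite: MoeglinVignerasWaldspurger1987, Chap. 2 II.1 (B)] -/
theorem MpPsi.proj_ofScalar (c : kˣ) : MpPsi.proj ρ (MpPsi.ofScalar ρ c) = 1 := rfl

/-- `i` is injective as soon as `S ≠ 0`. [cite: MoeglinVignerasWaldspurger1987, Chap. 2 II.1 (B)] -/
theorem MpPsi.ofScalar_injective [IsDomain k] [Nontrivial S] [NoZeroSMulDivisors k S] :
    Function.Injective (MpPsi.ofScalar ρ) := by
  intro c c' e
  obtain ⟨f, hf⟩ := exists_ne (0 : S)
  have := congrArg (fun x : MpPsi ρ => ((x : symplecticGroup B × (S ≃ₗ[k] S)).2 : S ≃ₗ[k] S) f) e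
  simp only [MpPsi.coe_ofScalar, scalarOp_apply] at this
  exact Units.ext (smul_left_injective k hf this)

/-- `i(kˣ)` is central in `MpPsi ρ` (the operators are `k`-linear). [cite: MoeglinVignerasWaldspurger1987, Chap. 2 II.1 (B)] -/
theorem MpPsi.ofScalar_mem_center (c : kˣ) : MpPsi.ofScalar ρ c ∈ Subgroup.center (MpPsi ρ) := by
  rw [Subgroup.mem_center_iff]
  intro x
  apply Subtype.ext
  refine Prod.ext ?_ (LinearEquiv.ext fun f => ?_)
  · simp
  · simp [LinearEquiv.mul_apply, map_smul]

/-! ## §2 The two hypotheses and the exactness of (B) -/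

/-- **existence of implementers** (the content of MVW II.1 before (A), as a predicate on the model `ρ`): every
`g ∈ Sp(W)` admits some `M ∈ GL(S)` with (A). [cite: MoeglinVignerasWaldspurger1987, Chap. 2 II.1 (A)] -/
def ExistsImplementer : Prop :=
  ∀ g : symplecticGroup B, ∃ M : S ≃ₗ[k] S, Implements ρ (ofSymplectic B g) M

/-- **uniqueness of implementers up to a scalar** (MVW II.1 "De plus M est unique à un scalaire près", as a predicate
on the model `ρ`). [cite: MoeglinVignerasWaldspurger1987, Chap. 2 II.1 (A)] -/
def ImplementerUniqueUpToScalar : Prop :=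
  ∀ (g : symplecticGroup B) (M M' : S ≃ₗ[k] S), Implements ρ (ofSymplectic B g) M →
    Implements ρ (ofSymplectic B g) M' → ∃ c : kˣ, ∀ f : S, M' f = (c : k) • M f

/-- `p` is surjective when implementers exist. [cite: MoeglinVignerasWaldspurger1987, Chap. 2 II.1 (B)] -/
theorem MpPsi.proj_surjective (hE : ExistsImplementer ρ) : Function.Surjective (MpPsi.proj ρ) := by
  intro g
  obtain ⟨M, hM⟩ := hE g
  exact ⟨⟨(g, M), hM⟩, rfl⟩

/-- `ker p ⊆ im i` when implementers are unique up to scalars (applied at `g = 1`, where `id` implements).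
[cite: MoeglinVignerasWaldspurger1987, Chap. 2 II.1 (B)] -/
theorem MpPsi.mem_range_ofScalar_of_proj_eq_one (hU : ImplementerUniqueUpToScalar ρ) (x : MpPsi ρ)
    (hx : MpPsi.proj ρ x = 1) : x ∈ (MpPsi.ofScalar ρ).range := by
  have hA : Implements ρ (ofSymplectic B 1) (x : symplecticGroup B × (S ≃ₗ[k] S)).2 := by
    have := x.2
    rw [mem_MpPsi] at this
    rw [MpPsi.proj_apply] at hx
    rwa [hx] at this
  have h1 : Implements ρ (ofSymplectic B 1) (1 : S ≃ₗ[k] S) := by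
    intro h f; simp [Heisenberg.PseudoSymplectic.act_one]
  obtain ⟨c, hc⟩ := hU 1 1 _ h1 hA
  refine ⟨c, Subtype.ext (Prod.ext ?_ (LinearEquiv.ext fun f => ?_))⟩
  · rw [MpPsi.proj_apply] at hx
    simp [hx]
  · simp [hc f]

/-- `ker p = im i` under uniqueness up to scalars. [cite: MoeglinVignerasWaldspurger1987, Chap. 2 II.1 (B)] -/
theorem MpPsi.ker_proj_eq_range_ofScalar (hU : ImplementerUniqueUpToScalar ρ) :
    (MpPsi.proj ρ).ker = (MpPsi.ofScalar ρ).range := by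
  ext x
  constructor
  · intro hx
    exact MpPsi.mem_range_ofScalar_of_proj_eq_one ρ hU x ((MonoidHom.mem_ker).1 hx)
  · rintro ⟨c, rfl⟩
    exact (MonoidHom.mem_ker).2 (MpPsi.proj_ofScalar ρ c)

/-- **(B) is a central extension** `1 → kˣ → MpPsi ρ → Sp(W) → 1` (tree predicate `IsCentralExt`), KERNEL over the
two hypotheses. [cite: MoeglinVignerasWaldspurger1987, Chap. 2 II.1 (B)] -/
theorem isCentralExt_MpPsi (hE : ExistsImplementer ρ) (hU : ImplementerUniqueUpToScalar ρ) :
    IsCentralExt (MpPsi.ofScalar ρ) (MpPsi.proj ρ) :=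
  ⟨MpPsi.ofScalar_mem_center ρ, fun x hx => MpPsi.mem_range_ofScalar_of_proj_eq_one ρ hU x hx,
    MpPsi.proj_surjective ρ hE⟩

end MpPsi

end Literature.RepresentationTheory.HeisenbergGroup
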